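import Literature.AlgebraicGeometry.Morphisms.CechModuleAffine
import Literature.AlgebraicGeometry.Morphisms.CechModuleH2AffineBasic
import Literature.AlgebraicGeometry.Morphisms.CechModuleH2TwoCovers
import Mathlib.AlgebraicGeometry.Morphisms.Separated
import HarnessLib

/-!
# Vanishing of `Ȟ²` on affine opens covered by affine opens; independence of the affine cover for
# the vanishing of `Ȟ²` of a quasi-coherent module

The degree-`2` companions of `Literature/AlgebraicGeometry/Morphisms/CechModuleAffine.lean`
(`cechMZ1_le_cechMB1_of_isAffineOpen`, Görtz–Wedhorn II Lemma 22.1 in degree `1`) and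
`CechModuleCoverIndependence.lean` (`subsingleton_cechMH1_iff_of_isAffineOpen`).  For a scheme
`f : X → Spec A` and an affine-localizing (e.g. QUASI-COHERENT,
`Literature.AlgebraicGeometry.Modules.IsAffineLocalizing.of_isQuasicoherent`) sheaf of `𝒪_X`-modules
`M`, in the FULL ORDERED Čech complex (`CechModuleH2`: `cechMZ2 ≤ cechMB2` iff
`Subsingleton (CechMH2 …)`, `subsingleton_cechMH2_iff`):

* `cechMZ1_le_cechMB1_of_le`, `cechMZ2_le_cechMB2_of_le` — **a family one of whose members `U_{i₀}`
  contains all the others has `Ȟ¹ = Ȟ² = 0`** (cocycles are coboundaries; any sheaf of modules):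
  the contracting homotopy `h(s)_{i_0 … i_n} = s_{i₀ i_0 … i_n}` of Görtz–Wedhorn II, proof of
  Lemma 21.76, in degrees `1` and `2` (`b_i = c_{i₀ i}|`, `c_{ij} = e_{i₀ i j}|`);
* `cechMZ2_le_cechMB2_of_isAffineOpen` — **`Ȟ²(𝒲, M) = 0` for an affine open `V` and every family
  `𝒲 = (W_j)` of AFFINE opens with `⋃_j W_j = V`** (Görtz–Wedhorn II Lemma 22.1 with Thm. 22.9 on
  the affine, hence separated, scheme `V`; Hartshorne III Thm. 3.5 with Thm. 4.5).  Unlike degree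
  `1`, in degree `2` the members `W_j` must be affine (for arbitrary opens `W_j` of an affine `V`,
  `Ȟ²(𝒲, M)` need not vanish); their pairwise intersections are then affine automatically, but this
  is not used.  Proof, Čech-internally: finitely many principal opens `D(r_l) ⊆ W_{τ l}` cover the
  quasi-compact `V`; on `𝒟 = (D(r_l))_l` every `2`-cocycle is a coboundary
  (`cechMZ2_le_cechMB2_basicOpen`, Görtz–Wedhorn I Lemma 12.33); the vanishing transfers from `𝒟`
  to `𝒲` through the double complex of the two families (`cechMZ2_le_cechMB2_of_two_covers`): the
  cross families `(D(r_l) ∩ W_j)_j`, `(D(r_l) ∩ D(r_{l'}) ∩ W_j)_j` contain their unions (member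
  `j = τ l`; `cechMZ2_le_cechMB2_of_le`, `cechMZ1_le_cechMB1_of_le`) and `(D(r_l) ∩ W_j)_l` covers
  the AFFINE `W_j` (`cechMZ1_le_cechMB1_of_isAffineOpen`);
* `cechMZ2_le_cechMB2_of_isAffineOpen_of_iSup_eq_top` — for two families `𝒰 = (U_i)`,
  `𝒰' = (U'_j)` covering `X` with `U_i`, `U_i ∩ U_{i'}`, `U'_j`, `U_i ∩ U'_j` affine: if every
  `2`-cocycle of `M` on `𝒰` is a `2`-coboundary then so is every `2`-cocycle on `𝒰'` — again
  `cechMZ2_le_cechMB2_of_two_covers`, with the inputs `Ȟ²((U_i ∩ U'_j)_j) = 0` (previous item on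
  the affine `U_i`), `Ȟ¹((U_i ∩ U_{i'} ∩ U'_j)_j) = 0` and `Ȟ¹((U_i ∩ U'_j)_i) = 0` (degree `1` on
  the affine `U_i ∩ U_{i'}`, `U'_j`);
* `cechMZ2_le_cechMB2_iff_of_isAffineOpen`, `subsingleton_cechMH2_iff_of_isAffineOpen` —
  **`Ȟ²(𝒰, M) = 0 ↔ Ȟ²(𝒰', M) = 0`** for two affine open covers with affine pairwise intersections
  `U_i ∩ U_{i'}`, `U'_j ∩ U'_{j'}`, `U_i ∩ U'_j`; `subsingleton_cechMH2_iff_of_isSeparated` — the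
  same for any two affine open covers of a SEPARATED scheme (Mathlib `IsAffineOpen.inf`).

This is the cover-independence half of "the cohomology of a quasi-coherent sheaf on a separated
scheme may be computed by the Čech complex of any affine open cover" (Görtz–Wedhorn II Thm. 22.9;
Hartshorne III Thm. 4.5) in degree `2`, proved Čech-internally (no derived functors); no finiteness
of the covers is needed.  Everything is proved; no named facts; no definitions.  Mathlib searched
(pin v4.32): `IsAffineOpen.exists_basicOpen_le`, `IsAffineOpen.isCompact`,
`IsAffineOpen.iSup_basicOpen_eq_self_iff`, `IsCompact.elim_finite_subcover`, `IsAffineOpen.inf`,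
`Scheme.IsSeparated` (used); no Čech cohomology of sheaves of modules on schemes.

## References

* U. Görtz, T. Wedhorn, *Algebraic Geometry II: Cohomology of Schemes*, Springer Spektrum (2023),
  doi:10.1007/978-3-658-43031-3: Lemma 21.76 (proof: the homotopy `h`), p. 264; Lemma 22.1,
  p. 327; Thm. 22.9, p. 332. [GortzWedhorn2023]
* U. Görtz, T. Wedhorn, *Algebraic Geometry I: Schemes*, 2nd ed. (2020): Prop. 12.32 and
  Lemma 12.33, p. 421. [GortzWedhorn2020]
* R. Hartshorne, *Algebraic Geometry*, GTM 52 (1977): III Thm. 3.5, III Thm. 4.5 (p. 222).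
  [Hartshorne1977]
* The Stacks Project, Tags 01X8, 01XD, 01KP. [StacksProject]
-/

noncomputable section

open CategoryTheory AlgebraicGeometry Limits TopologicalSpace Opposite

universe u v w

namespace Literature.AlgebraicGeometry.Morphisms

variable {A : Type u} [CommRing A] {X : Scheme.{u}} (f : X ⟶ Spec (.of A)) {M : X.Modules}

/-! ## Contractible families: a member containing all the others -/

section Contractible

variable (M) {ι : Type v} (U : ι → X.Opens)

/-- **A family one of whose members contains all the others has `Ȟ¹ = 0`**: if `U_i ⊆ U_{i₀}` for
all `i`, every `1`-cocycle `c` is the coboundary of `b_i = c_{i₀ i}|_{U_i}` (the contracting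
homotopy `h(s)_{i_0…} = s_{i₀ i_0 …}`).
[cite: GortzWedhorn2023, Lemma 21.76 proof (p. 264): the homotopy `h`] -/
theorem cechMZ1_le_cechMB1_of_le (i₀ : ι) (h : ∀ i, U i ≤ U i₀) :
    cechMZ1 f M U ≤ cechMB1 f M U := by
  intro c hc
  refine (mem_cechMB1_iff f M U c).mpr
    ⟨fun i => MSections.res f M (le_inf (h i) le_rfl : U i ≤ U i₀ ⊓ U i) (c i₀ i), ?_⟩
  funext i j
  rw [cechMD0_apply, MSections.res_res, MSections.res_res]
  have key := cechMZ1.cocycle_res f M U hc i₀ i j (inf_le_left.trans (h i) : U i ⊓ U j ≤ U i₀)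
    inf_le_left inf_le_right
  rw [MSections.res_eq_res f M _ (le_refl (U i ⊓ U j)) (c i j), MSections.res_self] at key
  -- `c_{ij} - c_{i₀ j}| + c_{i₀ i}| = 0`
  rw [MSections.res_eq_res f M _ (le_inf (inf_le_left.trans (h i)) inf_le_right) (c i₀ j),
    MSections.res_eq_res f M _ (le_inf (inf_le_left.trans (h i)) inf_le_left) (c i₀ i)]
  have e : ∀ (Cij C0j C0i : MSections f M (U i ⊓ U j)), Cij - C0j + C0i = 0 → C0j - C0i = Cij := by
    intro Cij C0j C0i h0
    rw [← sub_eq_zero]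
    have : C0j - C0i - Cij = -(Cij - C0j + C0i) := by abel
    rw [this, h0, neg_zero]
  exact e _ _ _ key

/-- **A family one of whose members contains all the others has `Ȟ² = 0`**: if `U_i ⊆ U_{i₀}` for
all `i`, every `2`-cocycle `e` is the coboundary of `c_{ij} = e_{i₀ i j}|_{U_i ∩ U_j}`.
[cite: GortzWedhorn2023, Lemma 21.76 proof (p. 264): the homotopy `h`] -/
theorem cechMZ2_le_cechMB2_of_le (i₀ : ι) (h : ∀ i, U i ≤ U i₀) :
    cechMZ2 f M U ≤ cechMB2 f M U := by
  intro e he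
  refine (mem_cechMB2_iff f M U e).mpr
    ⟨fun i j => MSections.res f M
      (le_inf (le_inf (inf_le_left.trans (h i)) inf_le_left) inf_le_right :
        U i ⊓ U j ≤ U i₀ ⊓ U i ⊓ U j) (e i₀ i j), ?_⟩
  funext i j k
  rw [cechMD1_apply, MSections.res_res, MSections.res_res, MSections.res_res]
  have hW0 : U i ⊓ U j ⊓ U k ≤ U i₀ := (inf_le_left.trans inf_le_left).trans (h i)
  have key := cechMZ2.cocycle_res f M U he i₀ i j k hW0 (inf_le_left.trans inf_le_left)
    (inf_le_left.trans inf_le_right) inf_le_right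
  rw [MSections.res_eq_res f M _ (le_refl (U i ⊓ U j ⊓ U k)) (e i j k), MSections.res_self] at key
  rw [MSections.res_eq_res f M _ (le_inf (le_inf hW0 (inf_le_left.trans inf_le_right)) inf_le_right)
      (e i₀ j k),
    MSections.res_eq_res f M _ (le_inf (le_inf hW0 (inf_le_left.trans inf_le_left)) inf_le_right)
      (e i₀ i k),
    MSections.res_eq_res f M _ (le_inf (le_inf hW0 (inf_le_left.trans inf_le_left))
      (inf_le_left.trans inf_le_right)) (e i₀ i j)]
  have e' : ∀ (Eijk E0jk E0ik E0ij : MSections f M (U i ⊓ U j ⊓ U k)),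
      Eijk - E0jk + E0ik - E0ij = 0 → E0jk - E0ik + E0ij = Eijk := by
    intro Eijk E0jk E0ik E0ij h0
    rw [← sub_eq_zero]
    have : E0jk - E0ik + E0ij - Eijk = -(Eijk - E0jk + E0ik - E0ij) := by abel
    rw [this, h0, neg_zero]
  exact e' _ _ _ _ key

end Contractible

variable (hM : Literature.AlgebraicGeometry.Modules.IsAffineLocalizing M)

include hM

/-! ## `Ȟ² = 0` on an affine open for families of affine opens -/

section Affine

/-- **Vanishing of `Ȟ²(𝒲, M)` on an affine open for every family `𝒲` of AFFINE opens covering it**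
(Görtz–Wedhorn II, Lemma 22.1 with Thm. 22.9 on the affine scheme `V`; Hartshorne III Thm. 3.5
with Thm. 4.5): for `M` affine-localizing (e.g. quasi-coherent), `V` affine and affine opens
`W_j ⊆ X` with `⋃_j W_j = V`, every Čech `2`-cocycle of `M` on `(W_j)_j` is a `2`-coboundary.
[cite: GortzWedhorn2023, Lemma 22.1 (p. 327) with Thm. 22.9 (p. 332)] -/
theorem cechMZ2_le_cechMB2_of_isAffineOpen {V : X.Opens} (hV : IsAffineOpen V) {J : Type v}
    (W : J → X.Opens) (hWaff : ∀ j, IsAffineOpen (W j)) (hW : ⨆ j, W j = V) :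
    cechMZ2 f M W ≤ cechMB2 f M W := by
  classical
  have hWV : ∀ j, W j ≤ V := fun j => (le_iSup W j).trans hW.le
  -- principal neighbourhoods inside the `W_j`
  have hpt : ∀ p : V, ∃ jr : J × Γ(X, V), X.basicOpen jr.2 ≤ W jr.1 ∧ (p : X) ∈ X.basicOpen jr.2 := by
    intro p
    have hp : (p : X) ∈ ⨆ j, W j := by rw [hW]; exact p.2
    obtain ⟨j, hj⟩ := Opens.mem_iSup.mp hp
    obtain ⟨g, hg, hpg⟩ := hV.exists_basicOpen_le ⟨(p : X), hj⟩ p.2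
    exact ⟨(j, g), hg, hpg⟩
  choose jr hjrW hjrp using hpt
  -- finitely many suffice
  obtain ⟨t, ht⟩ := hV.isCompact.elim_finite_subcover
    (fun p : V => (X.basicOpen (jr p).2 : Set X)) (fun p => (X.basicOpen (jr p).2).isOpen)
    (fun q hq => Set.mem_iUnion.mpr ⟨⟨q, hq⟩, hjrp ⟨q, hq⟩⟩)
  let r : ↥t → Γ(X, V) := fun l => (jr l.1).2
  let τ : ↥t → J := fun l => (jr l.1).1
  have hDW : ∀ l, X.basicOpen (r l) ≤ W (τ l) := fun l => hjrW l.1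
  have hcovD : ⨆ l, X.basicOpen (r l) = V := by
    apply le_antisymm (iSup_le fun l => X.basicOpen_le (r l))
    intro q hq
    obtain ⟨p, hp, hpq⟩ := Set.mem_iUnion₂.mp (ht hq)
    exact Opens.mem_iSup.mpr ⟨⟨p, hp⟩, hpq⟩
  have hspan : Ideal.span (Set.range r) = ⊤ := by
    rw [← hV.iSup_basicOpen_eq_self_iff, iSup_range']
    exact hcovD
  -- transfer from the principal covering `𝒟` (Lemma 12.33) to `𝒲` through the double complex
  refine cechMZ2_le_cechMB2_of_two_covers f M (fun l => X.basicOpen (r l)) W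
    (fun l => (X.basicOpen_le (r l)).trans hW.ge) (fun j => (hWV j).trans hcovD.ge)
    (fun l => ?_) (fun l l' => ?_) (fun j => ?_) (cechMZ2_le_cechMB2_basicOpen f hM hV r hspan)
  · -- `(D_l ∩ W_j)_j` contains its union `D_l = D_l ∩ W_{τ l}`
    exact cechMZ2_le_cechMB2_of_le f M (fun j => X.basicOpen (r l) ⊓ W j) (τ l)
      fun j => le_inf inf_le_left (inf_le_left.trans (hDW l))
  · -- `(D_l ∩ D_l' ∩ W_j)_j` contains its union `D_l ∩ D_l'`
    exact cechMZ1_le_cechMB1_of_le f M (fun j => X.basicOpen (r l) ⊓ X.basicOpen (r l') ⊓ W j) (τ l)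
      fun j => le_inf inf_le_left ((inf_le_left.trans inf_le_left).trans (hDW l))
  · -- `(D_l ∩ W_j)_l` covers the affine `W_j`
    refine cechMZ1_le_cechMB1_of_isAffineOpen f hM (hWaff j) (fun l => X.basicOpen (r l) ⊓ W j) ?_
    rw [← iSup_inf_eq, hcovD]
    exact inf_eq_right.mpr (hWV j)

/-- Class form: `Ȟ²((W_j)_j, M) = 0` for a family of affine opens covering an affine open and `M`
affine-localizing. [cite: GortzWedhorn2023, Lemma 22.1 (p. 327) with Thm. 22.9 (p. 332)] -/
theorem cechMH2_eq_zero_of_isAffineOpen {V : X.Opens} (hV : IsAffineOpen V) {J : Type v}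
    (W : J → X.Opens) (hWaff : ∀ j, IsAffineOpen (W j)) (hW : ⨆ j, W j = V) (x : CechMH2 f M W) :
    x = 0 := by
  obtain ⟨z, rfl⟩ := CechMH2.mk_surjective f M W x
  rw [CechMH2.mk_eq_zero_iff]
  exact cechMZ2_le_cechMB2_of_isAffineOpen f hM hV W hWaff hW z.2

/-- Class form on a subsingleton: `Ȟ²((W_j)_j, M)` is a subsingleton for a family of affine opens
covering an affine open and `M` affine-localizing.
[cite: GortzWedhorn2023, Lemma 22.1 (p. 327) with Thm. 22.9 (p. 332)] -/
theorem subsingleton_cechMH2_of_isAffineOpen {V : X.Opens} (hV : IsAffineOpen V) {J : Type v}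
    (W : J → X.Opens) (hWaff : ∀ j, IsAffineOpen (W j)) (hW : ⨆ j, W j = V) :
    Subsingleton (CechMH2 f M W) :=
  (subsingleton_cechMH2_iff f M W).mpr (cechMZ2_le_cechMB2_of_isAffineOpen f hM hV W hWaff hW)

end Affine

/-! ## Independence of the affine cover -/

section TwoCovers

variable {ι : Type v} {ι' : Type w} (U : ι → X.Opens) (U' : ι' → X.Opens)

/-- **Vanishing of `Ȟ²` passes between affine covers** (one direction, minimal hypotheses): for
`M` affine-localizing, two families `𝒰`, `𝒰'` covering `X` with `U_i`, `U_i ∩ U_{i'}`, `U'_j` and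
`U_i ∩ U'_j` affine, if every `2`-cocycle of `M` on `𝒰` is a `2`-coboundary then so is every
`2`-cocycle on `𝒰'` (Görtz–Wedhorn II Thm. 22.9 / Hartshorne III Thm. 4.5, degree `2`, through the
double complex of the two coverings).
[cite: GortzWedhorn2023, Thm. 22.9 (p. 332): degree 2, cover independence] -/
theorem cechMZ2_le_cechMB2_of_isAffineOpen_of_iSup_eq_top (hUaff : ∀ i, IsAffineOpen (U i))
    (hU2 : ∀ i i', IsAffineOpen (U i ⊓ U i')) (hU'aff : ∀ j, IsAffineOpen (U' j))
    (hUU' : ∀ i j, IsAffineOpen (U i ⊓ U' j)) (hU : ⨆ i, U i = ⊤) (hU' : ⨆ j, U' j = ⊤)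
    (h : cechMZ2 f M U ≤ cechMB2 f M U) : cechMZ2 f M U' ≤ cechMB2 f M U' := by
  refine cechMZ2_le_cechMB2_of_two_covers f M U U' (fun i => by rw [hU']; exact le_top)
    (fun j => by rw [hU]; exact le_top) (fun i => ?_) (fun i i' => ?_) (fun j => ?_) h
  · -- `Ȟ²((U_i ∩ U'_j)_j) = 0`: affine members covering the affine `U_i`
    refine cechMZ2_le_cechMB2_of_isAffineOpen f hM (hUaff i) (fun j => U i ⊓ U' j) (hUU' i) ?_
    rw [← inf_iSup_eq, hU', inf_top_eq]
  · -- `Ȟ¹((U_i ∩ U_i' ∩ U'_j)_j) = 0`: a family covering the affine `U_i ∩ U_i'`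
    refine cechMZ1_le_cechMB1_of_isAffineOpen f hM (hU2 i i') (fun j => U i ⊓ U i' ⊓ U' j) ?_
    rw [← inf_iSup_eq, hU', inf_top_eq]
  · -- `Ȟ¹((U_i ∩ U'_j)_i) = 0`: a family covering the affine `U'_j`
    refine cechMZ1_le_cechMB1_of_isAffineOpen f hM (hU'aff j) (fun i => U i ⊓ U' j) ?_
    rw [← iSup_inf_eq, hU, top_inf_eq]

/-- **Independence of `Ȟ²(𝒰, M) = 0` of the affine cover**: for `M` affine-localizing (e.g.
quasi-coherent) and two families `𝒰`, `𝒰'` of affine opens covering `X`, with affine pairwise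
intersections `U_i ∩ U_{i'}`, `U'_j ∩ U'_{j'}`, `U_i ∩ U'_j` (all automatic on a separated `X`),
every `2`-cocycle of `M` on `𝒰` is a `2`-coboundary iff every `2`-cocycle on `𝒰'` is.
[cite: GortzWedhorn2023, Thm. 22.9 (p. 332): degree 2, cover independence] -/
theorem cechMZ2_le_cechMB2_iff_of_isAffineOpen (hUaff : ∀ i, IsAffineOpen (U i))
    (hU'aff : ∀ j, IsAffineOpen (U' j)) (hU2 : ∀ i i', IsAffineOpen (U i ⊓ U i'))
    (hU'2 : ∀ j j', IsAffineOpen (U' j ⊓ U' j')) (hUU' : ∀ i j, IsAffineOpen (U i ⊓ U' j))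
    (hU : ⨆ i, U i = ⊤) (hU' : ⨆ j, U' j = ⊤) :
    cechMZ2 f M U ≤ cechMB2 f M U ↔ cechMZ2 f M U' ≤ cechMB2 f M U' :=
  ⟨cechMZ2_le_cechMB2_of_isAffineOpen_of_iSup_eq_top f hM U U' hUaff hU2 hU'aff hUU' hU hU',
    cechMZ2_le_cechMB2_of_isAffineOpen_of_iSup_eq_top f hM U' U hU'aff hU'2 hUaff
      (fun j i => by rw [inf_comm]; exact hUU' i j) hU' hU⟩

/-- **`Ȟ²(𝒰, M) = 0 ↔ Ȟ²(𝒰', M) = 0` for two affine open covers with affine pairwise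
intersections** and `M` affine-localizing (e.g. quasi-coherent) — class form of
`cechMZ2_le_cechMB2_iff_of_isAffineOpen`.
[cite: GortzWedhorn2023, Thm. 22.9 (p. 332): degree 2, cover independence] -/
theorem subsingleton_cechMH2_iff_of_isAffineOpen (hUaff : ∀ i, IsAffineOpen (U i))
    (hU'aff : ∀ j, IsAffineOpen (U' j)) (hU2 : ∀ i i', IsAffineOpen (U i ⊓ U i'))
    (hU'2 : ∀ j j', IsAffineOpen (U' j ⊓ U' j')) (hUU' : ∀ i j, IsAffineOpen (U i ⊓ U' j))
    (hU : ⨆ i, U i = ⊤) (hU' : ⨆ j, U' j = ⊤) :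
    Subsingleton (CechMH2 f M U) ↔ Subsingleton (CechMH2 f M U') := by
  rw [subsingleton_cechMH2_iff, subsingleton_cechMH2_iff]
  exact cechMZ2_le_cechMB2_iff_of_isAffineOpen f hM U U' hUaff hU'aff hU2 hU'2 hUU' hU hU'

/-- **`Ȟ²(𝒰, M) = 0 ↔ Ȟ²(𝒰', M) = 0` for any two affine open covers of a SEPARATED scheme** and `M`
affine-localizing (e.g. quasi-coherent): on a separated scheme the intersection of two affine opens
is affine (Mathlib `IsAffineOpen.inf`; Görtz–Wedhorn I Prop. 9.15).
[cite: GortzWedhorn2023, Thm. 22.9 (p. 332): degree 2, cover independence] -/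
theorem subsingleton_cechMH2_iff_of_isSeparated [X.IsSeparated] (hUaff : ∀ i, IsAffineOpen (U i))
    (hU'aff : ∀ j, IsAffineOpen (U' j)) (hU : ⨆ i, U i = ⊤) (hU' : ⨆ j, U' j = ⊤) :
    Subsingleton (CechMH2 f M U) ↔ Subsingleton (CechMH2 f M U') :=
  subsingleton_cechMH2_iff_of_isAffineOpen f hM U U' hUaff hU'aff (fun i i' => (hUaff i).inf (hUaff i'))
    (fun j j' => (hU'aff j).inf (hU'aff j')) (fun i j => (hUaff i).inf (hU'aff j)) hU hU'

end TwoCovers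

end Literature.AlgebraicGeometry.Morphisms

end
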